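import Mathlib
import Summits.ValiantsHypothesis.ValiantsHypothesis.Theses.NumTame
import Literature.Computability.AlgebraicComplexity.ConstantFreeValiant
import Literature.Computability.AlgebraicComplexity.BurgisserBooleanParts
import HarnessLib

/-!
# Route NumTame — the CORRECTED growth lemma behind `MagnitudeGlue` (support for stmt-ValiantsHypothesis-5388)

Item stmt-5388 (`MagnitudeGlue : MagnitudeNF → TameNF`) rests on the growth lemma «with fan-in two,
constants and weights `≤ 2^R` and all gate formal degrees `≤ D`, every gate value on the cube is
`≤ 2^((R+1)·D·(s+2))`». As filed this is FALSE: the empty product gate `prod []` has formal degree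
`0`, and chains of such gates reach doubly-exponential values at formal degree `0` (evidence on the
item; see the bus, val-lit-p8 g2 10:58Z). This file proves the REPAIRED lemma, under the extra
hypothesis that every gate has formal degree `≥ 1`:

  `‖g_j(x)‖ ≤ 2^((R+1)·(j+2)·fdeg_j)`   for every gate `j` and every Boolean point `x`
  (`norm_gateValues_le`), hence `≤ 2^((E+1)(E+2)E)` when size, formal degrees and constants are
  bounded by `E` resp. `2^E` (`tame_values_of_bounds`) — the exact shape `TameNF` consumes.

So the repaired item «`MagnitudeNF` with `∀ d ∈ gateFormalDegrees P'.gates, 1 ≤ d` ⇒ `TameNF`» is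
provable from this file by exponent bookkeeping alone.

Honest framing: bookkeeping for an open route; nothing here bears on VP ≠ VNP.

## References

* P. Bürgisser, *On defining integers and proving arithmetic circuit lower bounds*, Comput.
  Complexity 18 (2009), §2.2 (formal degree). [cite: Burgisser2006, §2.2]
* P. Bürgisser, *Completeness and Reduction in Algebraic Complexity Theory* (2000), Def. 2.1
  (circuits). [cite: Burgisser2000, Def. 2.1]
-/

set_option linter.dupNamespace false

noncomputable section

open MvPolynomial

namespace Summit.ValiantsHypothesis.ValiantsHypothesis.Theorems.NumTameGrowth

open Literature.Computability.AlgebraicComplexity ArithCircuit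

variable {σ : Type*} (x : σ → Bool) (R : ℕ)

/-- A Boolean point has coordinates of norm `≤ 1`. [folklore] -/
theorem norm_eval_X_le (i : σ) : ‖eval (boolPoint ℂ x) (X i : MvPolynomial σ ℂ)‖ ≤ 1 := by
  rw [eval_X, boolPoint_apply]
  split_ifs <;> simp

/-- **Operands.** If every earlier gate value satisfies `‖v_j(x)‖ ≤ 2^((R+1)(j+2)·d_j)`, then an
operand of gate number `J = |vals|` with constant of norm `≤ 2^R` has
`‖u(x)‖ ≤ 2^((R+1)(J+1)·fdeg u)`. [cite: Burgisser2006, §2.2] -/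
theorem norm_eval_operand_le (vals : List (MvPolynomial σ ℂ)) (degs : List ℕ)
    (hlen : vals.length = degs.length)
    (h : ∀ j (hj : j < vals.length),
      ‖eval (boolPoint ℂ x) vals[j]‖ ≤ 2 ^ ((R + 1) * (j + 2) * degs[j]'(hlen ▸ hj)))
    (u : Operand ℂ σ) (hu : ∀ a, u = Operand.const a → ‖a‖ ≤ 2 ^ R) :
    ‖eval (boolPoint ℂ x) (u.eval vals)‖ ≤
      (2 : ℝ) ^ ((R + 1) * (vals.length + 1) * u.formalDegree degs) := by
  cases u with
  | var i =>
    simp only [Operand.eval, Operand.formalDegree, mul_one]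
    exact (norm_eval_X_le x i).trans (one_le_pow₀ (by norm_num))
  | const c =>
    simp only [Operand.eval, Operand.formalDegree, eval_C, mul_one]
    calc ‖c‖ ≤ 2 ^ R := hu c rfl
      _ ≤ 2 ^ ((R + 1) * (vals.length + 1)) :=
          pow_le_pow_right₀ (by norm_num) (by nlinarith)
  | gate j =>
    simp only [Operand.eval, Operand.formalDegree, List.getD_eq_getElem?_getD]
    by_cases hj : j < vals.length
    · rw [List.getElem?_eq_getElem hj, List.getElem?_eq_getElem (hlen ▸ hj)]
      simp only [Option.getD_some]
      refine (h j hj).trans (pow_le_pow_right₀ (by norm_num) ?_)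
      exact Nat.mul_le_mul_right _ (Nat.mul_le_mul_left _ (by omega))
    · rw [List.getElem?_eq_none (by omega), List.getElem?_eq_none (by omega)]
      simp only [Option.getD_none, map_zero, norm_zero]
      positivity

/-- **Gates.** Under the same hypothesis, a gate of fan-in `≤ 2` with weights of norm `≤ 2^R` and
formal degree `D ≥ 1` has `‖g(x)‖ ≤ 2^((R+1)(J+2)·D)`: products add formal degrees, a weighted sum
costs one factor `2·2^R ≤ 2^((R+1)·D)`. [cite: Burgisser2006, §2.2] -/
theorem norm_eval_gate_le (vals : List (MvPolynomial σ ℂ)) (degs : List ℕ)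
    (hlen : vals.length = degs.length)
    (h : ∀ j (hj : j < vals.length),
      ‖eval (boolPoint ℂ x) vals[j]‖ ≤ 2 ^ ((R + 1) * (j + 2) * degs[j]'(hlen ▸ hj)))
    (g : Gate ℂ σ) (hfan : g.fanIn ≤ 2)
    (hconst : ∀ u ∈ g.args, ∀ a, u = Operand.const a → ‖a‖ ≤ 2 ^ R)
    (hw : ∀ args, g = Gate.sum args → ∀ a ∈ args, ‖a.1‖ ≤ 2 ^ R)
    (hdeg : 1 ≤ g.formalDegree degs) :
    ‖eval (boolPoint ℂ x) (g.eval vals)‖ ≤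
      (2 : ℝ) ^ ((R + 1) * (vals.length + 2) * g.formalDegree degs) := by
  have hop : ∀ u ∈ g.args, ‖eval (boolPoint ℂ x) (u.eval vals)‖ ≤
      (2 : ℝ) ^ ((R + 1) * (vals.length + 1) * u.formalDegree degs) :=
    fun u hu => norm_eval_operand_le x R vals degs hlen h u (hconst u hu)
  cases g with
  | prod args =>
    simp only [Gate.eval, Gate.formalDegree]
    simp only [Gate.args] at hop
    -- any number of factors: norms multiply, formal degrees add
    have key : ∀ l : List (Operand ℂ σ), (∀ u ∈ l, ‖eval (boolPoint ℂ x) (u.eval vals)‖ ≤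
        (2 : ℝ) ^ ((R + 1) * (vals.length + 1) * u.formalDegree degs)) →
        ‖eval (boolPoint ℂ x) (l.map fun u => u.eval vals).prod‖ ≤
          (2 : ℝ) ^ ((R + 1) * (vals.length + 1) * (l.map fun u => u.formalDegree degs).sum) := by
      intro l hl
      induction l with
      | nil => simp
      | cons u rest ih =>
        simp only [List.map_cons, List.prod_cons, List.sum_cons, map_mul, norm_mul]
        rw [Nat.mul_add, pow_add]
        exact mul_le_mul (hl u (by simp)) (ih fun v hv => hl v (by simp [hv])) (norm_nonneg _)
          (by positivity)
    refine (key args hop).trans (pow_le_pow_right₀ (by norm_num) ?_)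
    exact Nat.mul_le_mul_right _ (Nat.mul_le_mul_left _ (by omega))
  | sum args =>
    have hw' : ∀ a ∈ args, ‖a.1‖ ≤ 2 ^ R := hw args rfl
    simp only [Gate.fanIn, Gate.args, List.length_map] at hfan
    simp only [Gate.args, List.mem_map, forall_exists_index, and_imp,
      forall_apply_eq_imp_iff₂] at hop
    -- one summand, given a bound `D` on its formal degree
    have hterm : ∀ a ∈ args, ∀ D, a.2.formalDegree degs ≤ D →
        ‖eval (boolPoint ℂ x) (a.1 • a.2.eval vals)‖ ≤
          (2 : ℝ) ^ R * 2 ^ ((R + 1) * (vals.length + 1) * D) := by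
      intro a ha D hD
      rw [smul_eval, norm_mul]
      exact mul_le_mul (hw' a ha) ((hop a ha).trans
        (pow_le_pow_right₀ (by norm_num) (Nat.mul_le_mul_left _ hD))) (norm_nonneg _)
        (by positivity)
    -- the exponent step `2 · 2^R · 2^((R+1)(J+1)D) ≤ 2^((R+1)(J+2)D)` for `D ≥ 1`
    have hfin : ∀ D, 1 ≤ D → 2 * ((2 : ℝ) ^ R * 2 ^ ((R + 1) * (vals.length + 1) * D)) ≤
        2 ^ ((R + 1) * (vals.length + 2) * D) := by
      intro D hD
      rw [← mul_assoc, ← pow_succ', ← pow_add]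
      refine pow_le_pow_right₀ (by norm_num) ?_
      have : R + 1 ≤ (R + 1) * D := Nat.le_mul_of_pos_right _ hD
      nlinarith
    simp only [Gate.eval, Gate.formalDegree] at hdeg ⊢
    rcases args with _ | ⟨a, _ | ⟨b, _ | ⟨c, rest⟩⟩⟩
    · simp
    · simp only [List.map_cons, List.map_nil, List.sum_cons, List.sum_nil, add_zero,
        List.foldr_cons, List.foldr_nil] at hdeg ⊢
      have h1 := hterm a (by simp) _ (le_max_left (a.2.formalDegree degs) 0)
      have hpos : (0 : ℝ) ≤ 2 ^ R * 2 ^ ((R + 1) * (vals.length + 1) *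
          max (a.2.formalDegree degs) 0) := by positivity
      exact (h1.trans (by linarith)).trans (hfin _ hdeg)
    · simp only [List.map_cons, List.map_nil, List.sum_cons, List.sum_nil, add_zero,
        List.foldr_cons, List.foldr_nil] at hdeg ⊢
      have ha := hterm a (by simp) _ (le_max_left (a.2.formalDegree degs)
        (max (b.2.formalDegree degs) 0))
      have hb := hterm b (by simp) _ ((le_max_left (b.2.formalDegree degs) 0).trans
        (le_max_right (a.2.formalDegree degs) _))
      rw [map_add]
      refine ((norm_add_le _ _).trans (add_le_add ha hb)).trans ?_
      rw [← two_mul]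
      exact hfin _ hdeg
    · simp at hfan

/-- **The corrected growth lemma**: along a gate list with fan-in `≤ 2`, constants and weights of
norm `≤ 2^R`, and all formal degrees `≥ 1`, every gate value at a Boolean point satisfies
`‖g_j(x)‖ ≤ 2^((R+1)(j+2)·fdeg_j)`. [cite: Burgisser2006, §2.2] -/
theorem norm_gateValues_le (gs : List (Gate ℂ σ)) (hfan : ∀ g ∈ gs, g.fanIn ≤ 2)
    (hconst : ∀ g ∈ gs, ∀ u ∈ g.args, ∀ a, u = Operand.const a → ‖a‖ ≤ 2 ^ R)
    (hw : ∀ args, Gate.sum args ∈ gs → ∀ a ∈ args, ‖a.1‖ ≤ 2 ^ R)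
    (hdeg : ∀ d ∈ gateFormalDegrees gs, 1 ≤ d) :
    ∀ j (hj : j < (gateValues gs).length),
      ‖eval (boolPoint ℂ x) (gateValues gs)[j]‖ ≤
        (2 : ℝ) ^ ((R + 1) * (j + 2) * (gateFormalDegrees gs)[j]'(by simpa using hj)) := by
  induction gs using List.reverseRecOn with
  | nil => intro j hj; simp at hj
  | append_singleton gs g ih =>
    intro j hj
    have hlen : (gateValues gs).length = (gateFormalDegrees gs).length := by simp
    have ih' := ih (fun g' hg' => hfan g' (by simp [hg']))
      (fun g' hg' => hconst g' (by simp [hg']))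
      (fun args hargs => hw args (by simp [hargs]))
      (fun d hd => hdeg d (by simp [gateFormalDegrees_append_singleton, hd]))
    simp only [gateValues_append_singleton, gateFormalDegrees_append_singleton]
    rw [gateValues_append_singleton, List.length_append, List.length_singleton] at hj
    by_cases hj' : j < (gateValues gs).length
    · rw [List.getElem_append_left hj', List.getElem_append_left (hlen ▸ hj')]
      exact ih' j hj'
    · have hjeq : j = (gateValues gs).length := by omega
      subst hjeq
      rw [List.getElem_append_right (le_refl _)]
      rw [List.getElem_append_right (by simp)]
      simp only [Nat.sub_self, List.getElem_cons_zero, gateValues_length, gateFormalDegrees_length]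
      have hg := norm_eval_gate_le x R (gateValues gs) (gateFormalDegrees gs) hlen ih' g
        (hfan g (by simp)) (fun u hu => hconst g (by simp) u hu) (fun args hargs => hw args (by
          rw [← hargs]; simp)) (hdeg _ (by simp [gateFormalDegrees_append_singleton]))
      simpa [gateValues_length] using hg

/-- **Uniform form, as `TameNF` consumes it**: if a circuit `P'` has fan-in `≤ 2`, size `≤ E`,
constants and weights of norm `≤ 2^E`, all formal degrees in `[1, E]`, then every gate value at a
Boolean point has norm `≤ 2^((E+1)(E+2)E)`. [cite: Burgisser2006, §2.2] -/
theorem tame_values_of_bounds (P' : ArithCircuit ℂ σ) (E : ℕ) (hfan : P'.IsFanInTwo)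
    (hsize : P'.size ≤ E)
    (hconst : ∀ g ∈ P'.gates, ∀ u ∈ g.args, ∀ a, u = Operand.const a → ‖a‖ ≤ 2 ^ E)
    (hw : ∀ args, Gate.sum args ∈ P'.gates → ∀ a ∈ args, ‖a.1‖ ≤ 2 ^ E)
    (hdegpos : ∀ d ∈ gateFormalDegrees P'.gates, 1 ≤ d)
    (hdegle : ∀ d ∈ gateFormalDegrees P'.gates, d ≤ E) :
    ∀ g ∈ gateValues P'.gates, ∀ y : σ → Bool,
      ‖eval (boolPoint ℂ y) g‖ ≤ (2 : ℝ) ^ ((E + 1) * (E + 2) * E) := by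
  intro g hg y
  obtain ⟨j, hj, rfl⟩ := List.getElem_of_mem hg
  refine (norm_gateValues_le y E P'.gates hfan hconst hw hdegpos j hj).trans
    (pow_le_pow_right₀ (by norm_num) ?_)
  have hjE : j + 2 ≤ E + 2 := by
    have := gateValues_length P'.gates
    rw [ArithCircuit.size] at hsize
    omega
  have hdE : (gateFormalDegrees P'.gates)[j]'(by simpa using hj) ≤ E :=
    hdegle _ (List.getElem_mem _)
  exact Nat.mul_le_mul (Nat.mul_le_mul_left _ hjE) hdE

end Summit.ValiantsHypothesis.ValiantsHypothesis.Theorems.NumTameGrowth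

end
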